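import Literature.NumberTheory.Automorphic.ArchCellSecondOrderVanishing
import Mathlib.Geometry.Manifold.PartitionOfUnity
import HarnessLib

/-!
# Shalika's small-cell vanishing theorem for quasi-invariant Casimir eigendistributions on `GL_n(K_∞)`

[cite: Shalika1974, §2, Thm. 2.1 and Thm. 2.10]; [cite: Shalika1973, §5, footnote 5 (p. 460)];
[cite: HormanderALPDO1, Thm. 2.3.4, Thm. 2.3.5].

**Theorem** (`casimirSmallCellVanishing`).  Let `D` be a distribution on `GL_n(K_∞)` which is left and right
quasi-invariant under `U_n(K_∞)` for the generic character `ψ_∞` (`D(λ(u)f) = ψ(u) D f`, `D(ρ(u)f) = ψ(u)⁻¹ D f`),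
an eigendistribution of the Casimir operators of all the places, and which vanishes on the test functions
supported in the big cell `B w₀ B`.  Then `D = 0`.

This is the archimedean vanishing statement behind J. A. Shalika's multiplicity one theorem (Ann. of Math. 100
(1974), §2, with the Casimir hypothesis of Shalika, Bull. AMS 79 (1973), §5, fn. 5).  The proof is the cell-by-cell
analysis assembled from `ArchSmallCellFirstOrderStep` (first order, Hörmander Thm. 2.3.4) and
`ArchCellSecondOrderVanishing` (second order, Hörmander Thm. 2.3.5):

* §1 localisation on the group (a distribution vanishing near every point vanishes);
* §2 combinatorics: a permutation `σ ≠ rev` has an adjacent bad pair, and `rankSum σ ≤ rankSum rev` (so the big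
  cell at a place is open);
* §3 the choice of the root datum `θ` making the first-order datum non-degenerate (types 1 and 4);
* §4 the induction over the Bruhat cells at one place, inside an open set on which the top cell is settled;
* §5 the induction over the places and the theorem.

It feeds `multiplicity_one_gl_of_casimirSmallCellVanishing` (`ArchCasimirInvolution`).  Everything is proved; no
new facts.
-/

noncomputable section

open NumberField NumberField.InfinitePlace NumberField.mixedEmbedding Set Filter Matrix Complex
open Literature.Analysis.Distribution
open scoped MatrixGroups Topology Classical ContDiff Matrix.Norms.Operator ComplexConjugate Manifold

namespace Literature.NumberTheory.Automorphic

set_option backward.isDefEq.respectTransparency false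

variable {n : ℕ} {K : Type} [Field K] [NumberField K]

local notation "R∞" => mixedSpace K
local notation "Mat" => Matrix (Fin n) (Fin n) (mixedSpace K)
local notation "G∞" => GL (Fin n) (mixedSpace K)
local notation "E∞" => CellParam n (mixedSpace K)

/-- `M_n(K_∞)` is finite-dimensional over `ℝ` (local instance, as in `ArchBigCellDerivatives`). [folklore] -/
private theorem finiteDimensional_matrix_mixedSpace_sv : FiniteDimensional ℝ (Matrix (Fin n) (Fin n) (mixedSpace K)) :=
  Module.Finite.matrix

attribute [local instance] finiteDimensional_matrix_mixedSpace_sv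

/-- The parameter space is finite-dimensional over `ℝ` (local instance). [folklore] -/
private theorem finiteDimensional_cellParam_sv : FiniteDimensional ℝ (CellParam n (mixedSpace K)) := by
  unfold CellParam; infer_instance

attribute [local instance] finiteDimensional_cellParam_sv

/-! ### 1. Localisation on the group -/

section Localisation

/-- **Smooth multipliers**: `g ↦ ρ(g) f(g)` is a test function for a smooth `ρ` on `M_n(K_∞)` and a test
function `f`. [folklore] -/
theorem isArchTestFunction_ofReal_mul {ρ : Mat → ℝ} (hρ : ContDiff ℝ ∞ ρ) {f : G∞ → ℂ} (hf : IsArchTestFunction n K f) :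
    IsArchTestFunction n K (fun g => ((ρ (g : Mat) : ℝ) : ℂ) * f g) := by
  refine ⟨(Complex.continuous_ofReal.comp (hρ.continuous.comp Units.continuous_val)).mul hf.continuous,
    hf.hasCompactSupport.mul_left, IsArchTestFunction.isArchSmooth_of_contDiff_slice fun g => ?_⟩
  have hval : ∀ M : Mat, ((g * expGL M : G∞) : Mat) = (g : Mat) * NormedSpace.exp M := fun M => by
    rw [Units.val_mul, coe_expGL]
  simp only [hval]
  exact (Complex.ofRealCLM.contDiff.comp (hρ.comp (contDiff_const.mul contDiff_exp_mat))).mul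
    (contDiff_comp_mul_expGL_of_isArchSmooth hf.isArchSmooth g)

/-- **A distribution on `GL_n(K_∞)` vanishing near every point vanishes** (finite induction on a cover of the
support, with smooth cutoffs on `M_n(K_∞)`). [cite: HormanderALPDO1, Thm. 2.2.1] -/
theorem eq_zero_of_forall_archVanishesNear (D : ↥(archTestFunctions n K) →ₗ[ℂ] ℂ) (h : ∀ y : G∞, ArchVanishesNear D y)
    (f : ↥(archTestFunctions n K)) : D f = 0 := by
  choose U hU hDU using h
  -- open vanishing neighbourhoods
  have hU' : ∀ y : G∞, ∃ V : Set G∞, IsOpen V ∧ y ∈ V ∧ V ⊆ U y := fun y => by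
    obtain ⟨V, hVU, hVo, hyV⟩ := mem_nhds_iff.1 (hU y)
    exact ⟨V, hVo, hyV, hVU⟩
  choose V hVo hyV hVU using hU'
  -- induction on a finite subcover of the support
  suffices key : ∀ (t : Finset G∞) (f : ↥(archTestFunctions n K)), tsupport (f : G∞ → ℂ) ⊆ ⋃ y ∈ t, V y → D f = 0 by
    obtain ⟨t, ht⟩ := f.2.hasCompactSupport.elim_finite_subcover V hVo fun y _ => mem_iUnion.2 ⟨y, hyV y⟩
    exact key t f ht
  intro t
  induction t using Finset.induction_on with
  | empty =>
    intro f hf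
    simp only [Finset.notMem_empty, iUnion_of_empty, iUnion_empty, subset_empty_iff] at hf
    have h0 : f = 0 := by
      apply Subtype.ext
      funext g
      have : g ∉ tsupport (f : G∞ → ℂ) := by rw [hf]; exact notMem_empty g
      exact image_eq_zero_of_notMem_tsupport this
    rw [h0, map_zero]
  | insert a t ha ih =>
    intro f hf
    -- the compact part of the support not covered by the other sets
    set C : Set G∞ := tsupport (f : G∞ → ℂ) \ ⋃ y ∈ t, V y with hC
    have hCc : IsCompact C := f.2.hasCompactSupport.diff (isOpen_biUnion fun y _ => hVo y)
    have hCa : C ⊆ V a := by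
      intro g hg
      have h1 := hf hg.1
      rw [Finset.set_biUnion_insert] at h1
      exact h1.resolve_right hg.2
    -- a smooth cutoff on `M_n(K_∞)`: `χ = 1` near `val '' C`, `tsupport χ ⊆ val '' V a`
    have hoe : _root_.Topology.IsOpenEmbedding ((↑) : G∞ → Mat) := Units.isOpenEmbedding_val
    have ht' : IsClosed (((↑) : G∞ → Mat) '' C) := (hCc.image Units.continuous_val).isClosed
    have hs' : IsClosed (((↑) : G∞ → Mat) '' V a)ᶜ := (hoe.isOpenMap _ (hVo a)).isClosed_compl
    have hdisj : Disjoint (((↑) : G∞ → Mat) '' V a)ᶜ (((↑) : G∞ → Mat) '' C) :=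
      disjoint_compl_left.mono_right (image_mono hCa)
    obtain ⟨χ, hχ0, hχ1, -⟩ := exists_contMDiffMap_zero_one_nhds_of_isClosed (I := 𝓘(ℝ, Mat)) (n := (⊤ : ℕ∞)) hs' ht' hdisj
    have hχs : ContDiff ℝ ∞ (χ : Mat → ℝ) := contMDiff_iff_contDiff.1 χ.contMDiff
    -- the two pieces
    set f₁ : G∞ → ℂ := fun g => ((χ (g : Mat) : ℝ) : ℂ) * (f : G∞ → ℂ) g with hf₁
    set f₂ : G∞ → ℂ := fun g => (((1 - χ (g : Mat) : ℝ) : ℝ) : ℂ) * (f : G∞ → ℂ) g with hf₂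
    have hf₁t : IsArchTestFunction n K f₁ := isArchTestFunction_ofReal_mul hχs f.2
    have hf₂t : IsArchTestFunction n K f₂ :=
      isArchTestFunction_ofReal_mul (ρ := fun M => 1 - χ M) (contDiff_const.sub hχs) f.2
    have hsum : f = ⟨f₁, hf₁t⟩ + ⟨f₂, hf₂t⟩ := by
      apply Subtype.ext
      funext g
      simp only [Submodule.coe_add, Pi.add_apply, hf₁, hf₂]
      push_cast
      ring
    -- `f₁` is supported in `V a`
    have h1 : D ⟨f₁, hf₁t⟩ = 0 := by
      refine hDU a ⟨f₁, hf₁t⟩ ((fun g hg => hVU a ?_) : tsupport f₁ ⊆ U a)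
      obtain ⟨O, hOs, hOo, hO0⟩ : ∃ O : Set Mat, (((↑) : G∞ → Mat) '' V a)ᶜ ⊆ O ∧ IsOpen O ∧ ∀ x ∈ O, χ x = 0 := by
        obtain ⟨O, hO, hOsub⟩ := mem_nhdsSet_iff_exists.1 hχ0
        exact ⟨O, hOsub.1, hO, fun x hx => hOsub.2 hx⟩
      have hsupp : tsupport f₁ ⊆ ((↑) : G∞ → Mat) ⁻¹' Oᶜ := by
        refine closure_minimal (fun g hg => ?_) ((hOo.isClosed_compl).preimage Units.continuous_val)
        intro hgO
        exact hg (by simp only [hf₁, hO0 _ hgO, Complex.ofReal_zero, zero_mul])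
      have hg' := hsupp hg
      simp only [mem_preimage, mem_compl_iff] at hg'
      have : ((g : G∞) : Mat) ∈ ((↑) : G∞ → Mat) '' V a := by
        by_contra hn
        exact hg' (hOs hn)
      obtain ⟨g', hg'V, hgg'⟩ := this
      rwa [← Units.ext hgg']
    -- `f₂` is supported in the other sets
    have h2 : D ⟨f₂, hf₂t⟩ = 0 := by
      refine ih ⟨f₂, hf₂t⟩ fun g hg => ?_
      obtain ⟨O, hOs, hOo, hO1⟩ : ∃ O : Set Mat, ((↑) : G∞ → Mat) '' C ⊆ O ∧ IsOpen O ∧ ∀ x ∈ O, χ x = 1 := by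
        obtain ⟨O, hO, hOsub⟩ := mem_nhdsSet_iff_exists.1 hχ1
        exact ⟨O, hOsub.1, hO, fun x hx => hOsub.2 hx⟩
      have hsupp : tsupport f₂ ⊆ tsupport (f : G∞ → ℂ) ∩ ((↑) : G∞ → Mat) ⁻¹' Oᶜ := by
        refine closure_minimal (fun g hg => ⟨subset_closure ?_, ?_⟩)
          ((isClosed_tsupport _).inter ((hOo.isClosed_compl).preimage Units.continuous_val))
        · intro h0
          exact hg (by simp only [hf₂, h0, mul_zero])
        · intro hgO
          exact hg (by simp only [hf₂, hO1 _ hgO, sub_self, Complex.ofReal_zero, zero_mul])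
      obtain ⟨hg1, hg2⟩ := hsupp hg
      simp only [mem_preimage, mem_compl_iff] at hg2
      by_contra hnot
      exact hg2 (hOs ⟨g, ⟨hg1, hnot⟩, rfl⟩)
    rw [hsum, map_add, h1, h2, add_zero]

end Localisation

/-! ### 2. Combinatorics of the cells -/

section Combinatorics

/-- `patFn σ` is a bijection. [folklore] -/
theorem patFn_bijective (σ : Equiv.Perm (Fin n)) : Function.Bijective (patFn σ) :=
  (σ.symm.bijective.comp Fin.rev_bijective)

/-- **A permutation other than `rev` has an adjacent bad pair** `(i, i + 1)` (its pattern function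
`σ⁻¹ ∘ rev` is not increasing). [folklore] -/
theorem exists_adjacent_badPair {m : ℕ} (σ : Equiv.Perm (Fin (m + 1))) (hσ : σ ≠ Fin.revPerm) :
    ∃ i : Fin m, badPair σ i.castSucc i.succ := by
  by_contra h
  simp only [not_exists] at h
  have hmono : StrictMono (patFn σ) := Fin.strictMono_iff_lt_succ.2 fun i => by
    have h1 := h i
    rw [badPair_iff, not_and] at h1
    have h2 := h1 (Fin.castSucc_lt_succ)
    exact lt_of_le_of_ne (not_lt.1 h2) fun heq => (Fin.castSucc_lt_succ (i := i)).ne ((patFn_bijective σ).1 heq)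
  have hid : patFn σ = _root_.id :=
    (hmono.range_inj strictMono_id).1 (by rw [Set.range_id]; exact (patFn_bijective σ).2.range_eq)
  have hsymm : σ.symm = Fin.revPerm := Equiv.ext fun i => by
    have h1 := congr_fun hid i.rev
    simp only [patFn, Fin.rev_rev, _root_.id] at h1
    rw [Fin.revPerm_apply, h1]
  exact hσ (by rw [← Fin.revPerm_symm, ← hsymm, Equiv.symm_symm])

/-- **`rankSum σ ≤ rankSum rev`**: `Σ (i+1)(n - σ i) ≤ Σ (i+1)²` by `2ab ≤ a² + b²` and a reindexing.
[folklore] -/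
theorem rankSum_le_rankSum_revPerm (σ : Equiv.Perm (Fin n)) :
    rankSum (_root_.id : Fin n → Fin n) σ ≤ rankSum (_root_.id : Fin n → Fin n) Fin.revPerm := by
  rw [rankSum_id_eq, rankSum_id_eq]
  have hrev : ∀ i : Fin n, n - ((Fin.revPerm i : Fin n) : ℕ) = (i : ℕ) + 1 := fun i => by
    rw [Fin.revPerm_apply, Fin.val_rev]; omega
  simp only [hrev]
  -- `Σ (n - σ i)² = Σ (i + 1)²`
  have hsq : ∑ i : Fin n, (n - ((σ i : Fin n) : ℕ)) * (n - ((σ i : Fin n) : ℕ)) = ∑ i : Fin n, ((i : ℕ) + 1) * ((i : ℕ) + 1) := by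
    rw [Equiv.sum_comp σ (fun j : Fin n => (n - (j : ℕ)) * (n - (j : ℕ))), ← Equiv.sum_comp Fin.revPerm]
    refine Finset.sum_congr rfl fun i _ => ?_
    rw [Fin.revPerm_apply, Fin.val_rev]
    have := i.isLt
    congr 1 <;> omega
  have hterm : ∀ i : Fin n, 2 * (((i : ℕ) + 1) * (n - ((σ i : Fin n) : ℕ))) ≤
      ((i : ℕ) + 1) * ((i : ℕ) + 1) + (n - ((σ i : Fin n) : ℕ)) * (n - ((σ i : Fin n) : ℕ)) := fun i => by
    nlinarith [Nat.zero_le (((i : ℕ) + 1)), Nat.zero_le (n - ((σ i : Fin n) : ℕ)),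
      sq_nonneg (((i : ℕ) + 1 : ℤ) - ((n - ((σ i : Fin n) : ℕ) : ℕ) : ℤ))]
  have hsum := Finset.sum_le_sum fun i (_ : i ∈ Finset.univ) => hterm i
  rw [← Finset.mul_sum, Finset.sum_add_distrib, hsq, ← two_mul] at hsum
  exact Nat.le_of_mul_le_mul_left hsum two_pos

omit [NumberField K] in
/-- **The big cell at a place is open**: `placeCell v rev` is open. [folklore] -/
theorem isOpen_placeCell_revPerm (v : PlaceIdx K) : IsOpen (placeCell (n := n) v Fin.revPerm) := by
  rw [isOpen_iff_mem_nhds]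
  intro g hg
  obtain ⟨N, hN, hgN, hsub⟩ := exists_isOpen_inter_placeLevelLT_subset v Fin.revPerm hg
  rw [placeLevelLT_eq_univ v fun τ => Nat.lt_succ_of_le (rankSum_le_rankSum_revPerm τ), inter_univ] at hsub
  exact mem_of_superset (hN.mem_nhds hgN) hsub

omit [NumberField K] in
/-- The cell of a point at a place is unique. [folklore] -/
theorem eq_of_mem_placeCell (v : PlaceIdx K) {σ τ : Equiv.Perm (Fin n)} {g : G∞} (hσ : g ∈ placeCell v σ) (hτ : g ∈ placeCell v τ) :
    σ = τ := by
  by_contra h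
  exact Set.disjoint_left.1 (disjoint_placeCell v h) hσ hτ

end Combinatorics

/-! ### 3. The root datum -/

section Theta

variable (v : PlaceIdx K)

/-- `Tr(1_v) ≠ 0` (`= 1` at a real place, `= 2` at a complex place). [folklore] -/
theorem mixedTrace_placeIdem_ne_zero : mixedTrace K (placeIdem v : R∞) ≠ 0 := by
  rcases v with w | w
  · simp [mixedTrace_apply, placeIdem]
  · rw [mixedTrace_apply]
    have h1 : ∑ w' : {w : InfinitePlace K // IsComplex w}, 2 * ((placeIdem (Sum.inr w : PlaceIdx K) : R∞).2 w').re = 2 := by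
      rw [Finset.sum_eq_single w (fun w' _ hw' => by simp [placeIdem, Pi.single_eq_of_ne hw']) (fun h => absurd (Finset.mem_univ w) h)]
      simp [placeIdem]
    rw [h1]
    simp [placeIdem]

omit [NumberField K] in
/-- **A `v`-concentrated `θ` with `u θ = 1_v`** for `(u)_v ≠ 0`. [folklore] -/
theorem exists_theta_mul_eq_placeIdem {u : R∞} (hu : placeEmbC v u ≠ 0) :
    ∃ θ : R∞, (placeIdem v : R∞) * θ = θ ∧ u * θ = placeIdem v := by
  set z : R∞ := (placeIdem v : R∞) * u + (1 - placeIdem v) with hz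
  have hzv : ∀ v', placeEmbC v' z = if v' = v then placeEmbC v u else 1 := fun v' => by
    by_cases h : v' = v
    · subst h
      rw [if_pos rfl, hz, map_add, map_sub, map_one, placeEmbC_placeIdem_mul, if_pos rfl, placeEmbC_placeIdem, if_pos rfl]; ring
    · rw [if_neg h, hz, map_add, map_sub, map_one, placeEmbC_placeIdem_mul, if_neg h, placeEmbC_placeIdem, if_neg h]; ring
  have hzu : IsUnit z := isUnit_iff_placeEmbC_ne_zero.2 fun v' => by
    rw [hzv]; split_ifs
    · exact hu
    · exact one_ne_zero
  refine ⟨(placeIdem v : R∞) * ↑(hzu.unit⁻¹), by rw [← mul_assoc, placeIdem_mul_self], ext_placeEmbC fun v' => ?_⟩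
  rw [map_mul, map_mul, _root_.map_units_inv, placeEmbC_placeIdem, IsUnit.unit_spec, hzv]
  by_cases h : v' = v
  · subst h; rw [if_pos rfl, if_pos rfl]; field_simp
  · rw [if_neg h, if_neg h]; ring

/-- `dψ_∞` on an adjacent pair: `dψ(x E_{i,i+1}) = -2πi Tr(x)`. [folklore] -/
theorem archWhittakerDChar_of_adjacent {i j : Fin n} (hij : (i : ℕ) + 1 = j) (x : R∞) :
    archWhittakerDChar K i j x = ((-(2 * Real.pi) * mixedTrace K x : ℝ) : ℂ) * Complex.I := by
  unfold archWhittakerDChar; rw [if_pos hij]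

omit [NumberField K] in
/-- `-2π ≠ 0`. [folklore] -/
theorem neg_two_pi_ne_zero : (-(2 * Real.pi) : ℝ) ≠ 0 := by
  have := Real.pi_pos
  intro h0; linarith

/-- `dψ_∞` on an adjacent pair is non-zero when the trace is. [folklore] -/
theorem archWhittakerDChar_ne_zero_of_adjacent {i j : Fin n} (hij : (i : ℕ) + 1 = j) {x : R∞} (hx : mixedTrace K x ≠ 0) :
    archWhittakerDChar K i j x ≠ 0 := by
  rw [archWhittakerDChar_of_adjacent hij]
  refine mul_ne_zero ?_ Complex.I_ne_zero
  exact_mod_cast mul_ne_zero neg_two_pi_ne_zero hx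

end Theta

/-! ### 4. The induction over the cells at one place -/

section OnePlace

variable (v : PlaceIdx K)

/-- **A chart adapted to a point at every place**, with prescribed cell `σ` at `v`. [folklore] -/
theorem exists_adapted_chart (σ : Equiv.Perm (Fin n)) {y : G∞} (hy : y ∈ placeCell v σ) :
    ∃ (τ : PlaceIdx K → Equiv.Perm (Fin n)) (e : E∞) (he : e ∈ cellSource n R∞), τ v = Fin.revPerm * σ ∧ multiPermGL τ * cellChartGL e he = y := by
  set σ' : PlaceIdx K → Equiv.Perm (Fin n) := fun v' => if v' = v then σ else (exists_mem_bruhatCell (placeGL v' y)).choose with hσ'def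
  have hσ'v : σ' v = σ := by simp [hσ'def]
  have hσ' : ∀ v', placeGL v' y ∈ bruhatCell (K := ℂ) (σ' v') := by
    intro v'
    by_cases h : v' = v
    · subst h; rw [hσ'v]; exact hy
    · simp only [hσ'def, h, if_false]; exact (exists_mem_bruhatCell (placeGL v' y)).choose_spec
  have hbig : (((multiPermGL (fun v' => Fin.revPerm * σ' v') : G∞)⁻¹ * y : G∞) : Mat) ∈ bruhatBigCell n R∞ :=
    inv_multiPermGL_mul_mem_bruhatBigCell y σ' hσ'
  obtain ⟨e, he, hye⟩ := exists_chart_point hbig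
  exact ⟨fun v' => Fin.revPerm * σ' v', e, he, by show Fin.revPerm * σ' v = _; rw [hσ'v], hye⟩

/-- The indices of an adjacent pair after reversal: `rev j + 1 = rev i`. [folklore] -/
theorem rev_adjacent {i j : Fin n} (hij : (i : ℕ) + 1 = j) : ((j.rev : Fin n) : ℕ) + 1 = i.rev := by
  rw [Fin.val_rev, Fin.val_rev]; have := j.isLt; omega

/-- **Step 2 on the group for an adjacent bad pair**: at a point `y` of the cell `σ` at `v` with an adjacent bad pair
`(i₀, j₀)` which is either of type 1 (`f i₀ ≠ f j₀ + 1`) or of type 4 with distinct torus components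
`t_{σ⁻¹(rev j₀)} ≠ t_{σ⁻¹(rev i₀)}`, off-cell vanishing near `y` implies vanishing near `y`. [cite: Shalika1974, §2, Thm. 2.1] -/
theorem archVanishesNear_of_adjacent_step2 {T : ↥(archTestFunctions n K) →ₗ[ℂ] ℂ} (hT : IsArchDistribution n K T)
    (hL : ∀ (u : ↥(upperUnitriangular (Fin n) (mixedSpace K))) (f : ↥(archTestFunctions n K)),
      T (archTestFunctions.leftTranslate (u : G∞) f) = archWhittakerChar n K u * T f)
    (hR : ∀ (u : ↥(upperUnitriangular (Fin n) (mixedSpace K))) (f : ↥(archTestFunctions n K)),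
      T (archTestFunctions.rightTranslate (u : G∞) f) = (archWhittakerChar n K u)⁻¹ * T f)
    (σ : Equiv.Perm (Fin n)) {i₀ j₀ : Fin n} (hbad : badPair σ i₀ j₀) (hadj : (i₀ : ℕ) + 1 = j₀) {y : G∞} (hy : y ∈ placeCell v σ)
    (hcase : ¬((patFn σ j₀ : ℕ) + 1 = patFn σ i₀) ∨
      cellDiag σ (placeGL v y) (σ.symm j₀.rev) ≠ cellDiag σ (placeGL v y) (σ.symm i₀.rev))
    (hoff : ∃ U ∈ 𝓝 y, ∀ y' ∈ U, y' ∉ placeCell v σ → ArchVanishesNear T y') :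
    ArchVanishesNear T y := by
  obtain ⟨τ, e, he, hτ, hye⟩ := exists_adapted_chart v σ hy
  have hb : piBad v σ (e.1 : Mat) = 0 := (piBad_eq_zero_iff_mem_bruhatCell v σ hτ he).2 (by rw [hye]; exact hy)
  have hoff' : ∃ U ∈ 𝓝 y, ∀ y' ∈ U, placeGL v y' ∉ bruhatCell (K := ℂ) σ → ArchVanishesNear T y' := hoff
  have hrev : ((j₀.rev : Fin n) : ℕ) + 1 = i₀.rev := rev_adjacent hadj
  by_cases h4 : (patFn σ j₀ : ℕ) + 1 = patFn σ i₀
  swap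
  · -- type 1: `θ = 1_v a_p a_q⁻¹`, so that `a_p⁻¹ θ a_q = 1_v`
    set θ : R∞ := (placeIdem v : R∞) * (e.2.1 j₀.rev * ↑((he i₀.rev).unit⁻¹)) with hθdef
    have hθ : (placeIdem v : R∞) * θ = θ := by rw [hθdef, ← mul_assoc, placeIdem_mul_self]
    have htw : (↑((he j₀.rev).unit⁻¹) : R∞) * θ * e.2.1 i₀.rev = placeIdem v := by
      rw [hθdef]
      calc (↑((he j₀.rev).unit⁻¹) : R∞) * ((placeIdem v : R∞) * (e.2.1 j₀.rev * ↑((he i₀.rev).unit⁻¹))) * e.2.1 i₀.rev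
          = (placeIdem v : R∞) * ((↑((he j₀.rev).unit⁻¹) : R∞) * e.2.1 j₀.rev) * ((↑((he i₀.rev).unit⁻¹) : R∞) * e.2.1 i₀.rev) := by ring
        _ = placeIdem v := by rw [IsUnit.val_inv_mul, IsUnit.val_inv_mul, mul_one, mul_one]
    have hND : archWhittakerDChar K (patFn σ j₀) (patFn σ i₀) θ ≠
        archWhittakerDChar K j₀.rev i₀.rev (↑((he j₀.rev).unit⁻¹) * θ * e.2.1 i₀.rev) := by
      rw [htw]
      have h0 : archWhittakerDChar K (patFn σ j₀) (patFn σ i₀) θ = 0 := by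
        unfold archWhittakerDChar; rw [if_neg h4]
      rw [h0]
      exact (archWhittakerDChar_ne_zero_of_adjacent hrev (mixedTrace_placeIdem_ne_zero v)).symm
    exact archVanishesNear_of_firstOrder v σ i₀ j₀ θ hT hL hR hy hbad hθ hτ he hye hND hoff'
  · -- type 4 with distinct torus components: `θ` with `(1 - a_p⁻¹ a_q) θ = 1_v`
    have hne : cellDiag σ (placeGL v y) (σ.symm j₀.rev) ≠ cellDiag σ (placeGL v y) (σ.symm i₀.rev) :=
      hcase.resolve_left fun h => h h4
    have hp : placeEmbC v (e.2.1 j₀.rev) ≠ placeEmbC v (e.2.1 i₀.rev) := by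
      rwa [placeEmbC_torus_eq_cellDiag v σ hτ he hb, placeEmbC_torus_eq_cellDiag v σ hτ he hb, hye]
    have hpz : placeEmbC v (e.2.1 j₀.rev) ≠ 0 := (isUnit_iff_placeEmbC_ne_zero.1 (he j₀.rev)) v
    set u : R∞ := 1 - ↑((he j₀.rev).unit⁻¹) * e.2.1 i₀.rev with hudef
    have hu : placeEmbC v u ≠ 0 := by
      rw [hudef, map_sub, map_one, map_mul, _root_.map_units_inv, IsUnit.unit_spec]
      intro h0
      apply hp
      have h1 : (placeEmbC v (e.2.1 j₀.rev))⁻¹ * placeEmbC v (e.2.1 i₀.rev) = 1 := (sub_eq_zero.1 h0).symm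
      calc placeEmbC v (e.2.1 j₀.rev) = placeEmbC v (e.2.1 j₀.rev) * ((placeEmbC v (e.2.1 j₀.rev))⁻¹ * placeEmbC v (e.2.1 i₀.rev)) := by
            rw [h1, mul_one]
        _ = placeEmbC v (e.2.1 i₀.rev) := by rw [← mul_assoc, mul_inv_cancel₀ hpz, one_mul]
    obtain ⟨θ, hθ, huθ⟩ := exists_theta_mul_eq_placeIdem v hu
    have hdiff : θ - ↑((he j₀.rev).unit⁻¹) * θ * e.2.1 i₀.rev = placeIdem v := by rw [← huθ, hudef]; ring
    have hND : archWhittakerDChar K (patFn σ j₀) (patFn σ i₀) θ ≠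
        archWhittakerDChar K j₀.rev i₀.rev (↑((he j₀.rev).unit⁻¹) * θ * e.2.1 i₀.rev) := by
      rw [archWhittakerDChar_of_adjacent h4, archWhittakerDChar_of_adjacent hrev]
      intro heq
      have h1 := mul_right_cancel₀ Complex.I_ne_zero heq
      have h2 : (-(2 * Real.pi) * mixedTrace K θ : ℝ) = -(2 * Real.pi) * mixedTrace K (↑((he j₀.rev).unit⁻¹) * θ * e.2.1 i₀.rev) := by
        exact_mod_cast h1
      have h3 := mul_left_cancel₀ neg_two_pi_ne_zero h2
      have h5 : mixedTrace K (θ - ↑((he j₀.rev).unit⁻¹) * θ * e.2.1 i₀.rev) = 0 := by rw [map_sub, h3, sub_self]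
      rw [hdiff] at h5
      exact mixedTrace_placeIdem_ne_zero v h5
    exact archVanishesNear_of_firstOrder v σ i₀ j₀ θ hT hL hR hy hbad hθ hτ he hye hND hoff'

/-- **Step 3 on the group for an adjacent bad pair of type 4 with equal torus components**: off-cell vanishing
near `y` implies vanishing near `y` (the nearby on-cell points with distinct torus components are settled by
Step 2). [cite: Shalika1974, §2, Thm. 2.1] -/
theorem archVanishesNear_of_adjacent_step3 {T : ↥(archTestFunctions n K) →ₗ[ℂ] ℂ} (hT : IsArchDistribution n K T)
    (hC : IsArchCasimirEigendistribution n K T)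
    (hL : ∀ (u : ↥(upperUnitriangular (Fin n) (mixedSpace K))) (f : ↥(archTestFunctions n K)),
      T (archTestFunctions.leftTranslate (u : G∞) f) = archWhittakerChar n K u * T f)
    (hR : ∀ (u : ↥(upperUnitriangular (Fin n) (mixedSpace K))) (f : ↥(archTestFunctions n K)),
      T (archTestFunctions.rightTranslate (u : G∞) f) = (archWhittakerChar n K u)⁻¹ * T f)
    (σ : Equiv.Perm (Fin n)) {i₀ j₀ : Fin n} (hbad : badPair σ i₀ j₀) (hadj : (i₀ : ℕ) + 1 = j₀) {y : G∞} (hy : y ∈ placeCell v σ)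
    (hrel : cellDiag σ (placeGL v y) (σ.symm j₀.rev) = cellDiag σ (placeGL v y) (σ.symm i₀.rev))
    (hoff : ∃ U ∈ 𝓝 y, ∀ y' ∈ U, y' ∉ placeCell v σ → ArchVanishesNear T y') :
    ArchVanishesNear T y := by
  have hp : (j₀.rev : Fin n) ≠ i₀.rev := fun h => by
    have := congrArg (fun k : Fin n => (k : ℕ)) h
    simp only [Fin.val_rev] at this
    have := j₀.isLt; omega
  obtain ⟨U, hU, hoffU⟩ := hoff
  obtain ⟨U', hU'U, hU'o, hyU'⟩ := mem_nhds_iff.1 hU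
  refine archVanishesNear_of_secondOrder v σ j₀.rev i₀.rev hT hC hL hR hy hp hrel ⟨U', hU'o.mem_nhds hyU', fun y' hy' hcond => ?_⟩
  by_cases hcell : y' ∈ placeCell v σ
  · exact archVanishesNear_of_adjacent_step2 v hT hL hR σ hbad hadj hcell (Or.inr (hcond hcell))
      ⟨U', hU'o.mem_nhds hy', fun y'' hy'' hoff'' => hoffU y'' (hU'U hy'') hoff''⟩
  · exact hoffU y' (hU'U hy') hcell

/-- **The induction over the cells at the place `v`.**  Let `D` be quasi-invariant on both sides and a Casimir
eigendistribution, and `C` an open set such that `D` vanishes near every point of `C` lying in the big cell at `v`.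
Then `D` vanishes near every point of `C`. [cite: Shalika1974, §2, Thm. 2.10] -/
theorem archVanishesNear_of_place {T : ↥(archTestFunctions n K) →ₗ[ℂ] ℂ} (hT : IsArchDistribution n K T)
    (hC : IsArchCasimirEigendistribution n K T)
    (hL : ∀ (u : ↥(upperUnitriangular (Fin n) (mixedSpace K))) (f : ↥(archTestFunctions n K)),
      T (archTestFunctions.leftTranslate (u : G∞) f) = archWhittakerChar n K u * T f)
    (hR : ∀ (u : ↥(upperUnitriangular (Fin n) (mixedSpace K))) (f : ↥(archTestFunctions n K)),
      T (archTestFunctions.rightTranslate (u : G∞) f) = (archWhittakerChar n K u)⁻¹ * T f)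
    {C : Set G∞} (hCo : IsOpen C) (hbase : ∀ y ∈ C, y ∈ placeCell v Fin.revPerm → ArchVanishesNear T y) :
    ∀ y ∈ C, ArchVanishesNear T y := by
  -- strong induction on `rankSum rev - rankSum σ(y)`
  suffices key : ∀ k : ℕ, ∀ y ∈ C, ∀ σ : Equiv.Perm (Fin n), y ∈ placeCell v σ →
      rankSum (_root_.id : Fin n → Fin n) Fin.revPerm - rankSum (_root_.id : Fin n → Fin n) σ = k → ArchVanishesNear T y by
    intro y hy
    obtain ⟨σ, hσ⟩ := exists_mem_placeCell v y
    exact key _ y hy σ hσ rfl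
  intro k
  induction k using Nat.strong_induction_on with
  | _ k ih =>
    intro y hyC σ hyσ hk
    by_cases hσ : σ = Fin.revPerm
    · subst hσ; exact hbase y hyC hyσ
    -- the off-cell vanishing near `y`, from the induction hypothesis
    obtain ⟨N, hNo, hyN, hNsub⟩ := exists_isOpen_inter_placeLevelLT_subset v σ hyσ
    have hoff : ∃ U ∈ 𝓝 y, ∀ y' ∈ U, y' ∉ placeCell v σ → ArchVanishesNear T y' := by
      refine ⟨N ∩ C, (hNo.inter hCo).mem_nhds ⟨hyN, hyC⟩, fun y' hy' hcell => ?_⟩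
      obtain ⟨σ', hσ'⟩ := exists_mem_placeCell v y'
      have hlev : y' ∉ placeLevelLT v (rankSum (_root_.id : Fin n → Fin n) σ + 1) := fun h => hcell (hNsub ⟨hy'.1, h⟩)
      have hrank : rankSum (_root_.id : Fin n → Fin n) σ + 1 ≤ rankSum (_root_.id : Fin n → Fin n) σ' := by
        by_contra hlt
        exact hlev ((mem_placeLevelLT_iff v _ y').2 ⟨σ', not_le.1 hlt, hσ'⟩)
      have hle := rankSum_le_rankSum_revPerm σ'
      refine ih (rankSum (_root_.id : Fin n → Fin n) Fin.revPerm - rankSum (_root_.id : Fin n → Fin n) σ') (by omega) y' hy'.2 σ' hσ' rfl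
    -- an adjacent bad pair of `σ ≠ rev`
    obtain ⟨m, rfl⟩ : ∃ m, n = m + 1 := by
      rcases Nat.eq_zero_or_eq_succ_pred n with h0 | h0
      · subst h0; exact absurd (Subsingleton.elim σ Fin.revPerm) hσ
      · exact ⟨_, h0⟩
    obtain ⟨i, hbad⟩ := exists_adjacent_badPair σ hσ
    have hadj : ((i.castSucc : Fin (m + 1)) : ℕ) + 1 = i.succ := by simp
    by_cases hcase : ¬(((patFn σ i.succ : Fin (m + 1)) : ℕ) + 1 = patFn σ i.castSucc) ∨
        cellDiag σ (placeGL v y) (σ.symm i.succ.rev) ≠ cellDiag σ (placeGL v y) (σ.symm i.castSucc.rev)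
    · exact archVanishesNear_of_adjacent_step2 v hT hL hR σ hbad hadj hyσ hcase hoff
    · obtain ⟨-, hrel⟩ := not_or.1 hcase
      exact archVanishesNear_of_adjacent_step3 v hT hC hL hR σ hbad hadj hyσ (not_not.1 hrel) hoff

end OnePlace

/-! ### 5. The theorem -/

section Theorem

/-- `multiPermGL` of the constant family `rev · rev = 1` is `1`. [folklore] -/
theorem multiPermGL_revPerm_mul_revPerm : (multiPermGL (fun _ : PlaceIdx K => (Fin.revPerm * Fin.revPerm : Equiv.Perm (Fin n))) : G∞) = 1 := by
  have h : (fun _ : PlaceIdx K => (Fin.revPerm * Fin.revPerm : Equiv.Perm (Fin n))) = fun _ => 1 := by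
    funext v; ext i; simp
  rw [h]
  exact Units.ext multiPermMatrix_one

/-- **Points in the big cell at every place lie in the big cell of `GL_n(K_∞)`.** [folklore] -/
theorem mem_bruhatBigCell_of_forall_placeCell {y : G∞} (hy : ∀ v : PlaceIdx K, y ∈ placeCell v Fin.revPerm) :
    ((y : G∞) : Mat) ∈ bruhatBigCell n R∞ := by
  have h := inv_multiPermGL_mul_mem_bruhatBigCell y (fun _ => Fin.revPerm) hy
  rwa [multiPermGL_revPerm_mul_revPerm, inv_one, one_mul] at h

/-- **Shalika's small-cell vanishing theorem** (the hypothesis `hVT` of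
`multiplicity_one_gl_of_casimirSmallCellVanishing`): a distribution on `GL_n(K_∞)`, left and right quasi-invariant
under `U_n(K_∞)`, an eigendistribution of the Casimir operators, anti-invariant under the Gelfand–Kazhdan involution
(not used) and vanishing on the test functions supported in the big cell, vanishes. [cite: Shalika1974, §2, Thm. 2.10] -/
theorem casimirSmallCellVanishing (D : ↥(archTestFunctions n K) →ₗ[ℂ] ℂ) (hD : IsArchDistribution n K D)
    (hL : ∀ (u : ↥(upperUnitriangular (Fin n) (mixedSpace K))) (f : ↥(archTestFunctions n K)),
      D (archTestFunctions.leftTranslate (u : GL (Fin n) (mixedSpace K)) f) = archWhittakerChar n K u * D f)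
    (hR : ∀ (u : ↥(upperUnitriangular (Fin n) (mixedSpace K))) (f : ↥(archTestFunctions n K)),
      D (archTestFunctions.rightTranslate (u : GL (Fin n) (mixedSpace K)) f) = (archWhittakerChar n K u)⁻¹ * D f)
    (hC : IsArchCasimirEigendistribution n K D)
    (hbig : ∀ f : ↥(archTestFunctions n K), tsupport (f : GL (Fin n) (mixedSpace K) → ℂ) ⊆
      {g : GL (Fin n) (mixedSpace K) | (g : Matrix (Fin n) (Fin n) (mixedSpace K)) ∈ bruhatBigCell n (mixedSpace K)} → D f = 0)
    (f : ↥(archTestFunctions n K)) : D f = 0 := by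
  refine eq_zero_of_forall_archVanishesNear D (fun y => ?_) f
  -- induction over the places: `D` vanishes near every point which is in the big cell at the places outside `S`
  suffices key : ∀ S : Finset (PlaceIdx K), ∀ y : G∞, (∀ v ∉ S, y ∈ placeCell v Fin.revPerm) → ArchVanishesNear D y by
    exact key Finset.univ y fun v hv => absurd (Finset.mem_univ v) hv
  intro S
  induction S using Finset.induction_on with
  | empty =>
    intro y hy
    have hyb : ((y : G∞) : Mat) ∈ bruhatBigCell n R∞ := mem_bruhatBigCell_of_forall_placeCell fun v => hy v (Finset.notMem_empty v)
    refine ⟨((↑) : G∞ → Mat) ⁻¹' bruhatBigCell n R∞, (isOpen_bruhatBigCell.preimage Units.continuous_val).mem_nhds hyb, fun g hg => hbig g hg⟩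
  | insert v S hv ih =>
    intro y hy
    have hCo : IsOpen {y' : G∞ | ∀ v' ∉ insert v S, y' ∈ placeCell v' Fin.revPerm} := by
      have : {y' : G∞ | ∀ v' ∉ insert v S, y' ∈ placeCell v' Fin.revPerm} = ⋂ v' ∈ (insert v S : Finset (PlaceIdx K))ᶜ, placeCell v' Fin.revPerm := by
        ext y'; simp
      rw [this]
      exact isOpen_biInter_finset fun v' _ => isOpen_placeCell_revPerm v'
    refine archVanishesNear_of_place v hD hC hL hR hCo (fun y' hy' hy'v => ih y' fun v' hv' => ?_) y hy
    by_cases h : v' = v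
    · subst h; exact hy'v
    · exact hy' v' (by simp [h, hv'])

end Theorem

end Literature.NumberTheory.Automorphic
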